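import Literature.NumberTheory.LFunctions.LargeValuesFourierDecay
import Mathlib.NumberTheory.ZetaValues
import Mathlib.Analysis.PSeries
import Mathlib.Analysis.Calculus.Deriv.Support
import HarnessLib

/-!
# Sampling a smooth compactly supported function along an arithmetic progression
# (Poisson summation with derivative decay) — a tool for Tao–Teräväinen 2022, Proposition 7.1

Topic `Literature/Barriers/Parity`, sub-namespace `TaoTeravainen`; a tool file of the proof DAG of
`Literature.Barriers.Parity.TaoTeravainen2021_prop72_81_pair` (T. Tao, J. Teräväinen, *The
Hardy–Littlewood–Chowla conjecture in the presence of a Siegel zero*, J. London Math. Soc. (2) 106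
(2022), arXiv:2109.06291). In the proof of Proposition 7.1 (i) the quantity `X` is handled "By
Fourier expansion and Poisson summation": a smooth weight at scale `≫ D q_χ²` summed over a residue
class to a modulus `≤ D^{1/2} q_χ²` equals its mean up to an error decaying faster than any power.
This file PROVES the one-variable sampling estimate used for that step (twice, once in each
variable, in `SiegelZeroDichotomyPairHLProp71.lean`):

* `norm_fourier_mul_pow_le` — `(2π|ξ|)^m |𝓕g(ξ)| ≤ ∫ |g⁽ᵐ⁾|` for `g ∈ C_c^∞(ℝ)` (Mathlib's
  `Real.fourier_iteratedDeriv`; cf. `GuthMaynardFourier.norm_fourier_le_of_iteratedDeriv` in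
  `Literature/NumberTheory/LFunctions/LargeValuesFourierDecay.lean`, whose compact-support lemmas are reused);
* `norm_tsum_sub_integral_le` — for `g ∈ C_c^∞(ℝ)` and `m ≥ 2`,
  `|∑_{k ∈ ℤ} g(x₀ + k) - ∫ g| ≤ (π²/3) (2π)^{-m} ∫ |g⁽ᵐ⁾|` (Poisson summation, Mathlib's
  `Real.tsum_eq_tsum_fourier_of_rpow_decay`, and `∑_{n ≠ 0} n⁻² = π²/3`);
* `norm_tsum_sub_div_integral_le` — the rescaled form: for `L > 0`,
  `|∑_{k ∈ ℤ} g(r + L k) - L⁻¹ ∫ g| ≤ (π²/3) (2π)^{-m} L^{m-1} ∫ |g⁽ᵐ⁾|`;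
* `sum_filter_modEq_eq_tsum` — a sum over the integers `1 ≤ n ≤ N` in a residue class `r (mod L)`
  of a function vanishing outside `(1/2, N + 1/2)` is the full lattice sum `∑_{k ∈ ℤ} g(r + L k)`.
  [cite: TaoTeravainen2021, proof of Proposition 7.1 ("By Fourier expansion and Poisson summation")]
-/

noncomputable section

open Real MeasureTheory Filter Asymptotics
open scoped FourierTransform Topology ContDiff

namespace Literature.Barriers.Parity

namespace TaoTeravainen

open Literature.NumberTheory.LFunctions (GuthMaynardFourier.hasCompactSupport_iteratedDeriv)

/-! ### `∑_{n ∈ ℤ} n⁻² = π²/3` -/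

/-- `∑_{n ∈ ℤ} 1/n² = π²/3` (with the convention `1/0 = 0`). [folklore] -/
theorem hasSum_one_div_int_sq : HasSum (fun n : ℤ => 1 / (n : ℝ) ^ 2) (π ^ 2 / 3) := by
  have h1 : HasSum (fun n : ℕ => 1 / (n : ℝ) ^ 2) (π ^ 2 / 6) := hasSum_zeta_two
  have h2 : HasSum (fun n : ℕ => 1 / ((n : ℝ) + 1) ^ 2) (π ^ 2 / 6) := by
    have h := (hasSum_nat_add_iff' (f := fun n : ℕ => 1 / (n : ℝ) ^ 2) 1).mpr hasSum_zeta_two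
    rw [Finset.sum_range_one, Nat.cast_zero, zero_pow two_ne_zero, div_zero, sub_zero] at h
    simpa using h
  have h := HasSum.of_nat_of_neg_add_one (f := fun n : ℤ => 1 / (n : ℝ) ^ 2)
    (by convert h1 using 1; funext n; push_cast; ring)
    (by convert h2 using 1; funext n; push_cast; ring)
  convert h using 1
  ring

/-! ### Fourier decay of a compactly supported smooth function -/

/-- Iterated derivatives of a compactly supported smooth function are integrable. [folklore] -/
theorem integrable_iteratedDeriv {g : ℝ → ℂ} (hg : ContDiff ℝ ∞ g) (hs : HasCompactSupport g)
    (n : ℕ) : Integrable (iteratedDeriv n g) :=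
  (hg.continuous_iteratedDeriv n (by exact_mod_cast le_top)).integrable_of_hasCompactSupport
    (GuthMaynardFourier.hasCompactSupport_iteratedDeriv hs n)

/-- **Fourier decay from `m` derivatives**: `(2π|ξ|)^m |𝓕g(ξ)| ≤ ∫ |g⁽ᵐ⁾|` for `g ∈ C_c^∞(ℝ)`
("from repeated integration by parts"; Mathlib's `Real.fourier_iteratedDeriv`). [folklore] -/
theorem norm_fourier_mul_pow_le {g : ℝ → ℂ} (hg : ContDiff ℝ ∞ g) (hs : HasCompactSupport g)
    (m : ℕ) (ξ : ℝ) : (2 * π * |ξ|) ^ m * ‖𝓕 g ξ‖ ≤ ∫ y, ‖iteratedDeriv m g y‖ := by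
  have hF := Real.fourier_iteratedDeriv (N := (⊤ : ℕ∞)) (n := m) hg
    (fun n _ => integrable_iteratedDeriv hg hs n) le_top
  have h1 : ‖𝓕 (iteratedDeriv m g) ξ‖ ≤ ∫ y, ‖iteratedDeriv m g y‖ :=
    VectorFourier.norm_fourierIntegral_le_integral_norm _ _ _ _ _
  rw [hF, norm_smul, norm_pow] at h1
  have h2 : ‖(2 * π * Complex.I * ξ : ℂ)‖ = 2 * π * |ξ| := by
    simp [abs_of_pos Real.pi_pos]
  rwa [h2] at h1

/-! ### Poisson summation with derivative decay -/

/-- A compactly supported function is `O` of anything at infinity. [folklore] -/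
theorem isBigO_cocompact_of_hasCompactSupport {g : ℝ → ℂ} (hs : HasCompactSupport g) (h : ℝ → ℝ) :
    g =O[cocompact ℝ] h := by
  have hev : g =ᶠ[cocompact ℝ] 0 := by
    have := hasCompactSupport_iff_eventuallyEq.mp hs
    rwa [Filter.coclosedCompact_eq_cocompact] at this
  refine IsBigO.of_bound 0 (hev.mono fun x hx => ?_)
  rw [hx, Pi.zero_apply, norm_zero, zero_mul]

/-- Eventually `1 ≤ |ξ|` along the cocompact filter of `ℝ`. [folklore] -/
theorem eventually_one_le_abs_cocompact : ∀ᶠ ξ : ℝ in cocompact ℝ, 1 ≤ |ξ| := by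
  rw [cocompact_eq_atBot_atTop, Filter.eventually_sup]
  constructor
  · filter_upwards [Filter.eventually_le_atBot (-1 : ℝ)] with ξ hξ
    rw [le_abs]; right; linarith
  · filter_upwards [Filter.eventually_ge_atTop (1 : ℝ)] with ξ hξ
    exact hξ.trans (le_abs_self ξ)

/-- **Poisson summation with derivative decay (period `1`)**: for `g ∈ C_c^∞(ℝ)` and `m ≥ 2`,
`|∑_{k ∈ ℤ} g(x₀ + k) - ∫ g| ≤ (π²/3) (2π)^{-m} ∫ |g⁽ᵐ⁾|`
(`∑_k g(x₀+k) = ∑_n 𝓕g(n) e(nx₀)`, the term `n = 0` being `∫ g` and the others bounded by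
`∫|g⁽ᵐ⁾| (2π|n|)^{-m} ≤ ∫|g⁽ᵐ⁾| (2π)^{-m} n⁻²`).
[cite: TaoTeravainen2021, proof of Proposition 7.1 ("Poisson summation")] -/
theorem norm_tsum_sub_integral_le {g : ℝ → ℂ} (hg : ContDiff ℝ ∞ g) (hs : HasCompactSupport g)
    {m : ℕ} (hm : 2 ≤ m) (x₀ : ℝ) :
    ‖(∑' k : ℤ, g (x₀ + k)) - ∫ y, g y‖ ≤ (π ^ 2 / 3) / (2 * π) ^ m * ∫ y, ‖iteratedDeriv m g y‖ := by
  set K : ℝ := ∫ y, ‖iteratedDeriv m g y‖ with hK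
  have hK0 : 0 ≤ K := integral_nonneg fun _ => norm_nonneg _
  have h2π : 0 < (2 * π) ^ m := by positivity
  set K' : ℝ := K / (2 * π) ^ m with hK'
  have hK'0 : 0 ≤ K' := div_nonneg hK0 h2π.le
  -- the Fourier transform is `≤ K'/ξ²` for `|ξ| ≥ 1`
  have hdecay : ∀ ξ : ℝ, 1 ≤ |ξ| → ‖𝓕 g ξ‖ ≤ K' * (1 / ξ ^ 2) := by
    intro ξ hξ
    have h1 := norm_fourier_mul_pow_le hg hs m ξ
    have hξ0 : 0 < |ξ| := lt_of_lt_of_le one_pos hξ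
    have hpow : (2 * π * |ξ|) ^ m = (2 * π) ^ m * |ξ| ^ m := by rw [mul_pow]
    rw [hpow] at h1
    have h3 : |ξ| ^ 2 ≤ |ξ| ^ m := pow_le_pow_right₀ hξ hm
    have h4 : ξ ^ 2 = |ξ| ^ 2 := (sq_abs ξ).symm
    rw [hK', h4, mul_one_div, div_div, le_div_iff₀ (by positivity)]
    calc ‖𝓕 g ξ‖ * ((2 * π) ^ m * |ξ| ^ 2) ≤ ‖𝓕 g ξ‖ * ((2 * π) ^ m * |ξ| ^ m) := by gcongr
      _ = (2 * π) ^ m * |ξ| ^ m * ‖𝓕 g ξ‖ := by ring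
      _ ≤ K := h1
  -- hypotheses of Poisson summation
  have hc : Continuous g := hg.continuous
  have hf : g =O[cocompact ℝ] (fun x : ℝ => |x| ^ (-(2 : ℝ))) :=
    isBigO_cocompact_of_hasCompactSupport hs _
  have hFf : (𝓕 g) =O[cocompact ℝ] (fun x : ℝ => |x| ^ (-(2 : ℝ))) := by
    refine IsBigO.of_bound K' ?_
    filter_upwards [eventually_one_le_abs_cocompact] with ξ hξ
    have hξ0 : 0 < |ξ| := lt_of_lt_of_le one_pos hξ
    rw [Real.norm_eq_abs, abs_of_pos (Real.rpow_pos_of_pos hξ0 _), Real.rpow_neg hξ0.le,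
      show (2 : ℝ) = ((2 : ℕ) : ℝ) by norm_num, Real.rpow_natCast, sq_abs, ← one_div]
    exact hdecay ξ hξ
  have hP := Real.tsum_eq_tsum_fourier_of_rpow_decay hc one_lt_two hf hFf x₀
  -- summability of the right-hand side
  set a : ℤ → ℂ := fun n => 𝓕 g n * fourier n (x₀ : UnitAddCircle) with ha
  have hnorm_a : ∀ n : ℤ, ‖a n‖ = ‖𝓕 g n‖ := by
    intro n
    rw [ha]
    simp only [norm_mul, fourier_apply, Circle.norm_coe, mul_one]
  set b : ℤ → ℝ := fun n => K' * (1 / (n : ℝ) ^ 2) + (if n = 0 then ‖𝓕 g 0‖ else 0) with hb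
  have hb_sum : Summable b :=
    ((Real.summable_one_div_int_pow.mpr one_lt_two).mul_left K').add
      (hasSum_ite_eq (0 : ℤ) _).summable
  have hb_apply : ∀ n : ℤ, b n = K' * (1 / (n : ℝ) ^ 2) + (if n = 0 then ‖𝓕 g 0‖ else 0) :=
    fun n => rfl
  have hab : ∀ n : ℤ, ‖a n‖ ≤ b n := by
    intro n
    rw [hnorm_a, hb_apply]
    by_cases hn : n = 0
    · rw [hn, if_pos rfl]
      simp only [Int.cast_zero, ne_eq, OfNat.ofNat_ne_zero, not_false_eq_true, zero_pow, div_zero,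
        mul_zero, zero_add, le_refl]
    · rw [if_neg hn, add_zero]
      refine hdecay n ?_
      rw [← Int.cast_abs]
      exact_mod_cast Int.one_le_abs hn
  have ha_sum : Summable a := Summable.of_norm_bounded hb_sum hab
  -- split off `n = 0`
  have hsplit := ha_sum.tsum_eq_add_tsum_ite 0
  have ha0 : a 0 = ∫ y, g y := by
    rw [ha]
    simp only [Int.cast_zero, fourier_zero, mul_one]
    rw [Real.fourier_real_eq]
    simp
  rw [hP, show (∑' n : ℤ, 𝓕 g n * fourier n (x₀ : UnitAddCircle)) = ∑' n : ℤ, a n from rfl, hsplit,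
    ha0, add_sub_cancel_left]
  -- the tail
  have htail_sum : Summable fun n : ℤ => ‖if n = 0 then (0 : ℂ) else a n‖ := by
    refine Summable.of_nonneg_of_le (fun _ => norm_nonneg _) (fun n => ?_) hb_sum
    split_ifs with hn
    · rw [norm_zero, hb_apply]
      have : 0 ≤ K' * (1 / (n : ℝ) ^ 2) := by positivity
      have h' : 0 ≤ (if n = 0 then ‖𝓕 g 0‖ else 0) := by rw [if_pos hn]; positivity
      linarith
    · exact hab n
  calc ‖∑' n : ℤ, (if n = 0 then (0 : ℂ) else a n)‖
      ≤ ∑' n : ℤ, ‖if n = 0 then (0 : ℂ) else a n‖ := norm_tsum_le_tsum_norm htail_sum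
    _ ≤ ∑' n : ℤ, K' * (1 / (n : ℝ) ^ 2) := by
        refine htail_sum.tsum_le_tsum (fun n => ?_)
          ((Real.summable_one_div_int_pow.mpr one_lt_two).mul_left K')
        split_ifs with hn
        · rw [norm_zero]; positivity
        · rw [hnorm_a]
          refine hdecay n ?_
          rw [← Int.cast_abs]
          exact_mod_cast Int.one_le_abs hn
    _ = K' * (π ^ 2 / 3) := by
        rw [tsum_mul_left, hasSum_one_div_int_sq.tsum_eq]
    _ = (π ^ 2 / 3) / (2 * π) ^ m * K := by rw [hK']; ring

/-- **The rescaled sampling estimate**: for `g ∈ C_c^∞(ℝ)`, `L > 0`, `r ∈ ℝ` and `m ≥ 2`,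
`|∑_{k ∈ ℤ} g(r + L k) - L⁻¹ ∫ g| ≤ (π²/3) (2π)^{-m} L^{m-1} ∫ |g⁽ᵐ⁾|`
(apply the period-`1` estimate to `y ↦ g(L y)`). [cite: TaoTeravainen2021, proof of Proposition 7.1] -/
theorem norm_tsum_sub_div_integral_le {g : ℝ → ℂ} (hg : ContDiff ℝ ∞ g) (hs : HasCompactSupport g)
    {m : ℕ} (hm : 2 ≤ m) {L : ℝ} (hL : 0 < L) (r : ℝ) :
    ‖(∑' k : ℤ, g (r + L * k)) - L⁻¹ * ∫ y, g y‖ ≤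
      (π ^ 2 / 3) / (2 * π) ^ m * L ^ (m - 1) * ∫ y, ‖iteratedDeriv m g y‖ := by
  obtain ⟨h, hh⟩ : ∃ h : ℝ → ℂ, h = fun y => g (L * y) := ⟨_, rfl⟩
  have hh_smooth : ContDiff ℝ ∞ h := by
    rw [hh]; exact hg.comp (contDiff_const.mul contDiff_id)
  have hh_supp : HasCompactSupport h := by
    have : h = fun y => g (L • y) := by funext y; rw [hh, smul_eq_mul]
    rw [this]
    exact hs.comp_smul hL.ne'
  have h1 := norm_tsum_sub_integral_le hh_smooth hh_supp hm (r / L)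
  -- identify the pieces
  have hsum : (∑' k : ℤ, h (r / L + k)) = ∑' k : ℤ, g (r + L * k) := by
    refine tsum_congr fun k => ?_
    rw [hh]
    show g (L * (r / L + k)) = g (r + L * k)
    rw [mul_add, mul_div_cancel₀ _ hL.ne']
  have hint : ∫ y, h y = L⁻¹ * ∫ y, g y := by
    rw [hh, MeasureTheory.Measure.integral_comp_mul_left g L, abs_of_pos (inv_pos.mpr hL),
      Complex.real_smul, Complex.ofReal_inv]
  have hder : ∫ y, ‖iteratedDeriv m h y‖ = L ^ (m - 1) * ∫ y, ‖iteratedDeriv m g y‖ := by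
    have hgm : ContDiff ℝ m g := hg.of_le (by exact_mod_cast le_top)
    have hd : iteratedDeriv m h = fun y => (L ^ m : ℝ) • iteratedDeriv m g (L * y) := by
      rw [hh]; exact iteratedDeriv_comp_const_smul hgm L
    rw [hd]
    have hn : ∀ y : ℝ, ‖(L ^ m : ℝ) • iteratedDeriv m g (L * y)‖ = L ^ m * ‖iteratedDeriv m g (L * y)‖ := by
      intro y
      rw [norm_smul, Real.norm_eq_abs, abs_of_pos (pow_pos hL m)]
    simp_rw [hn]
    rw [integral_const_mul, MeasureTheory.Measure.integral_comp_mul_left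
      (fun y => ‖iteratedDeriv m g y‖) L, abs_of_pos (inv_pos.mpr hL), smul_eq_mul, ← mul_assoc]
    congr 1
    have hm1 : m = (m - 1) + 1 := by omega
    conv_lhs => rw [hm1, pow_succ]
    rw [mul_assoc, mul_inv_cancel₀ hL.ne', mul_one]
  rw [hsum, hint, hder] at h1
  calc ‖(∑' k : ℤ, g (r + L * k)) - L⁻¹ * ∫ y, g y‖
      ≤ (π ^ 2 / 3) / (2 * π) ^ m * (L ^ (m - 1) * ∫ y, ‖iteratedDeriv m g y‖) := h1
    _ = (π ^ 2 / 3) / (2 * π) ^ m * L ^ (m - 1) * ∫ y, ‖iteratedDeriv m g y‖ := by ring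

/-! ### Lattice sums over a residue class -/

/-- **A residue-class sum of a function supported in `(1/2, N + 1/2)` is a full lattice sum**: for
`L ≥ 1`, `r ∈ ℤ` and `g` vanishing on `(-∞, 1/2]` and on `[N + 1/2, ∞)`,
`∑_{1 ≤ n ≤ N, n ≡ r (mod L)} g(n) = ∑_{k ∈ ℤ} g(r + L k)`. [folklore] -/
theorem sum_filter_modEq_eq_tsum {g : ℝ → ℂ} {N : ℕ} {L : ℕ} (hL : 0 < L) (r : ℤ)
    (hg₁ : ∀ y : ℝ, y ≤ 1 / 2 → g y = 0) (hg₂ : ∀ y : ℝ, (N : ℝ) + 1 / 2 ≤ y → g y = 0) :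
    ∑ n ∈ (Finset.Icc 1 N).filter (fun n : ℕ => (n : ℤ) ≡ r [ZMOD L]), g n =
      ∑' k : ℤ, g (r + (L : ℝ) * k) := by
  classical
  -- the finite set of lattice indices that can contribute
  set S : Finset ℤ := ((Finset.Icc 1 N).filter (fun n : ℕ => (n : ℤ) ≡ r [ZMOD L])).image
    (fun n : ℕ => ((n : ℤ) - r) / L) with hS
  have hL0 : (L : ℤ) ≠ 0 := by exact_mod_cast hL.ne'
  have hkey : ∀ n : ℕ, (n : ℤ) ≡ r [ZMOD L] → r + (L : ℤ) * (((n : ℤ) - r) / L) = n := by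
    intro n hn
    have hdvd : (L : ℤ) ∣ (n : ℤ) - r := (Int.ModEq.dvd hn.symm)
    rw [Int.mul_ediv_cancel' hdvd]
    ring
  rw [tsum_eq_sum (s := S) ?_]
  · -- the sum over `S` is the sum over the residue class, via `n ↦ (n - r)/L`
    rw [hS, Finset.sum_image]
    · refine Finset.sum_congr rfl fun n hn => ?_
      rw [Finset.mem_filter] at hn
      congr 1
      have := hkey n hn.2
      exact_mod_cast this.symm
    · intro n hn n' hn' h
      rw [Finset.coe_filter, Set.mem_setOf_eq] at hn hn'
      simp only at h
      have h1 := hkey n hn.2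
      have h2 := hkey n' hn'.2
      rw [h] at h1
      exact_mod_cast h1.symm.trans h2
  · -- outside `S` the summand vanishes
    intro k hk
    by_contra hne
    apply hk
    -- `1/2 < r + L k < N + 1/2`, so `n = r + L k ∈ [1, N]` and `k = (n - r)/L`
    have hlow : ¬ ((r : ℝ) + (L : ℝ) * k ≤ 1 / 2) := fun h => hne (hg₁ _ h)
    have hhigh : ¬ ((N : ℝ) + 1 / 2 ≤ (r : ℝ) + (L : ℝ) * k) := fun h => hne (hg₂ _ h)
    push Not at hlow hhigh
    have h1 : (1 : ℤ) ≤ r + L * k := by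
      by_contra h
      push Not at h
      have : (r : ℝ) + (L : ℝ) * k ≤ 0 := by exact_mod_cast Int.lt_add_one_iff.mp (by omega)
      linarith
    have h2 : r + L * k ≤ N := by
      by_contra h
      push Not at h
      have : ((N : ℤ) : ℝ) + 1 ≤ (r : ℝ) + (L : ℝ) * k := by exact_mod_cast h
      push_cast at this
      linarith
    obtain ⟨n, hn⟩ : ∃ n : ℕ, (n : ℤ) = r + L * k := ⟨(r + L * k).toNat, by
      rw [Int.toNat_of_nonneg (by omega)]⟩
    rw [hS, Finset.mem_image]
    refine ⟨n, ?_, ?_⟩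
    · rw [Finset.mem_filter, Finset.mem_Icc]
      refine ⟨⟨by exact_mod_cast hn ▸ h1, by exact_mod_cast hn ▸ h2⟩, ?_⟩
      rw [hn, Int.ModEq, Int.add_mul_emod_self_left]
    · rw [hn, add_sub_cancel_left, Int.mul_ediv_cancel_left _ hL0]

end TaoTeravainen

end Literature.Barriers.Parity
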